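import Mathlib

/-!
# Residue floor for the impurity channel (solo-informed, s14; claim C70/C71)

Abstract kernel of the VARIATIONAL FLOOR under a static susceptibility
(`paper/sharpest.md` §4.10(x), `work/s15/mott_summary.md` §4).  For a symmetric nonnegative
`M` (think `M = h(k) - E₀(N+1)` on the impurity sector at total momentum `k`) and a weak solution
`M u = a` (so that `⟪a, u⟫ = D(k)` is the impurity susceptibility of the plane wave `a = F₁`),
every test vector `w` gives

  `⟪a, w⟫² ≤ ⟪a, u⟫ · ⟪w, M w⟫`                      (`SoloInformed.weakInverse_floor`).

Physics instance (not formalised here): `w = e^{ik·x₁} Ψ₀^{N+1}` (the boosted ground state with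
particle `1` coloured) has `⟪w, M w⟫ = ε(k)` by the one-particle f-sum rule and
`⟪a, w⟫² = |⟨Ψ₀^N, a₀ Ψ₀^{N+1}⟩|² / (N+1) =: ζ_N`, the condensate residue; hence
`D(k) ε(k) ≥ ζ_N` for every `k`: a state with condensate residue cannot have a STIFF impurity
channel, while the unit-filling Mott state (`ζ = 2/(V+1)`) can and does (`Dε → 0`, C70); in the
ideal gas the floor is an equality (`Dε = ζ = 1`).

* `SoloInformed.realForm_cauchySchwarz` : Cauchy–Schwarz for the form `(x, y) ↦ ⟪x, M y⟫` of a (real;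
  the complex twin is `SoloInformed.form_cauchySchwarz` in `SoloInformedGaussianDomination`)
  symmetric nonnegative linear map (discriminant argument, no square roots);
* `SoloInformed.weakInverse_floor` : the floor above;
* `SoloInformed.weakInverse_floor_of_le` : with `⟪w, M w⟫ ≤ e` and `0 ≤ ⟪a, u⟫`,
  `⟪a, w⟫² ≤ ⟪a, u⟫ · e`.

Weak-inverse formulation as in the other `SoloInformed*` kernels; standard axioms only.
-/

namespace Summit.AtomisticToContinuum.BoseEinsteinCondensation.Theorems

open scoped InnerProductSpace

variable {E : Type*} [NormedAddCommGroup E] [InnerProductSpace ℝ E]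

/-- Cauchy–Schwarz for the bilinear form of a symmetric nonnegative linear map:
`⟪u, M w⟫² ≤ ⟪u, M u⟫ · ⟪w, M w⟫`. -/
theorem SoloInformed.realForm_cauchySchwarz (M : E →ₗ[ℝ] E)
    (hsym : ∀ x y : E, ⟪M x, y⟫_ℝ = ⟪x, M y⟫_ℝ) (hpos : ∀ w : E, 0 ≤ ⟪w, M w⟫_ℝ) (u w : E) :
    ⟪u, M w⟫_ℝ ^ 2 ≤ ⟪u, M u⟫_ℝ * ⟪w, M w⟫_ℝ := by
  set A := ⟪u, M u⟫_ℝ with hA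
  set b := ⟪u, M w⟫_ℝ with hb
  set c := ⟪w, M w⟫_ℝ with hc
  have hwu : ⟪w, M u⟫_ℝ = b := by
    rw [hb, ← hsym w u, real_inner_comm]
  -- the quadratic `t ↦ ⟪u - t•w, M (u - t•w)⟫` is nonnegative
  have key : ∀ t : ℝ, 0 ≤ A - 2 * t * b + t ^ 2 * c := by
    intro t
    have h := hpos (u - t • w)
    have hexp : ⟪u - t • w, M (u - t • w)⟫_ℝ = A - 2 * t * b + t ^ 2 * c := by
      rw [map_sub, map_smul, inner_sub_left, inner_sub_right, inner_sub_right,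
        real_inner_smul_left, real_inner_smul_left, real_inner_smul_right, real_inner_smul_right,
        hwu, ← hA, ← hb, ← hc]
      ring
    rw [hexp] at h
    exact h
  have hc0 : 0 ≤ c := hpos w
  rcases eq_or_lt_of_le hc0 with hczero | hcpos
  · -- `c = 0`: the linear function `A - 2 t b` is bounded below, so `b = 0`
    have hb0 : b = 0 := by
      by_contra hbne
      have h := key ((A + 1) / (2 * b))
      rw [← hczero] at h
      have h2 : 2 * ((A + 1) / (2 * b)) * b = A + 1 := by
        field_simp
      rw [h2] at h
      linarith
    rw [hb0, ← hczero]
    simp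
  · -- `c > 0`: evaluate at the vertex `t = b / c`
    have h := key (b / c)
    have h2 : A - 2 * (b / c) * b + (b / c) ^ 2 * c = A - b ^ 2 / c := by
      field_simp
      ring
    rw [h2] at h
    have h3 : b ^ 2 / c ≤ A := by linarith
    rw [div_le_iff₀ hcpos] at h3
    linarith

/-- RESIDUE FLOOR.  If `M` is symmetric and nonnegative and `u` is a weak solution of
`M u = a`, then for every test vector `w`, `⟪a, w⟫² ≤ ⟪a, u⟫ · ⟪w, M w⟫`; i.e. the
susceptibility `⟪a, M⁻¹ a⟫` is at least `⟪a, w⟫² / ⟪w, M w⟫`. -/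
theorem SoloInformed.weakInverse_floor (M : E →ₗ[ℝ] E)
    (hsym : ∀ x y : E, ⟪M x, y⟫_ℝ = ⟪x, M y⟫_ℝ) (hpos : ∀ w : E, 0 ≤ ⟪w, M w⟫_ℝ)
    {u a : E} (hMu : M u = a) (w : E) :
    ⟪a, w⟫_ℝ ^ 2 ≤ ⟪a, u⟫_ℝ * ⟪w, M w⟫_ℝ := by
  have h1 : ⟪a, w⟫_ℝ = ⟪u, M w⟫_ℝ := by
    rw [← hMu, hsym]
  have h2 : ⟪u, M u⟫_ℝ = ⟪a, u⟫_ℝ := by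
    rw [hMu, real_inner_comm]
  rw [h1, ← h2]
  exact SoloInformed.realForm_cauchySchwarz M hsym hpos u w

/-- The floor with an energy bound on the test vector: `⟪w, M w⟫ ≤ e` (f-sum: `e = ε(k)`) and
`0 ≤ ⟪a, u⟫` give `⟪a, w⟫² ≤ ⟪a, u⟫ · e`, i.e. `D(k) ε(k) ≥ ζ`. -/
theorem SoloInformed.weakInverse_floor_of_le (M : E →ₗ[ℝ] E)
    (hsym : ∀ x y : E, ⟪M x, y⟫_ℝ = ⟪x, M y⟫_ℝ) (hpos : ∀ w : E, 0 ≤ ⟪w, M w⟫_ℝ)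
    {u a : E} (hMu : M u = a) (w : E) {e : ℝ} (he : ⟪w, M w⟫_ℝ ≤ e) (hD : 0 ≤ ⟪a, u⟫_ℝ) :
    ⟪a, w⟫_ℝ ^ 2 ≤ ⟪a, u⟫_ℝ * e :=
  le_trans (SoloInformed.weakInverse_floor M hsym hpos hMu w) (mul_le_mul_of_nonneg_left he hD)

end Summit.AtomisticToContinuum.BoseEinsteinCondensation.Theorems
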